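import Literature.AnabelianGeometry.EtaleTheta.ThetaCoversModelDefs
import Literature.AnabelianGeometry.EtaleTheta.BarDeltaOfSetting
import HarnessLib

/-!
# [EtTh] §2 over §1: the tempered `Ker(Δ^tp_X ↠ Δ̄_X)` / `Δ̄_Θ`-preimage map INTO the profinite ones
# (proof-only; the formal half of the tempered ↔ profinite junction of W3-L2-02 phase 1)

Mochizuki, *The étale theta function …*, Publ. RIMS **45** (2009), §2 p. 35: "`Π_X ↠ Π̄_X` for the
quotient whose kernel is the kernel of the quotient `Δ_X ↠ Δ̄_X`" [cite: MochizukiEtTh2009, Def 2.1 p.35];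
§1 p. 12: `Π_X := (Π^tp_X)^∧`.

Cell abc-iut, layer L2, W3-L2-02 (L2-lead DEDUP ruling 2026-08-26T03:04:45Z / 03:16:46Z): the Δ-side model
subgroups exist in TWO readings — TEMPERED, inside `Π^tp_X` through the theta quotient
(`ThetaSetting.barKerTp / barThetaTp / powTheta`, `BarDeltaOfSetting.lean`, seat abc-iut-L2-d3) and
PROFINITE, inside `Π_X = D.PiHat` (`ThetaSetting.barKerHat / barThetaHat / deltaHatPow`,
`ThetaCoversModelDefs.lean`, seat abc-iut-L2-t10). PROVED here, hypothesis-free (the FORMAL direction of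
the junction; auditor abc-iut-L6-t23 03:36:03Z):

* `barKerTp_le_comap_barKerHat` — `Ker(Δ^tp_X ↠ Δ̄_X) ≤ toHat⁻¹(Ker(Δ_X ↠ Δ̄_X))`: `θ⁻¹(⟨l-th powers of
  θ(Δ^tp_X)⟩) = ⟨l-th powers of Δ^tp_X⟩ · Ker θ`, `toHat` of an `l`-th power is an `l`-th power, and
  `Ker θ = toHat⁻¹([[Δ_X,Δ_X],Δ_X]⁻)` (root field `ker_toTheta`);
* `barThetaTp_le_comap_barThetaHat` — the same for the `Δ̄_Θ`-preimages (`Δ_Θ`-part through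
  `Ker(Π^tp_X ↠ (Π^tp_X)^ell) = toHat⁻¹([Δ_X,Δ_X]⁻)`, root field `ker_toEll`).

The REVERSE inclusions (equality `barKerTp = toHat⁻¹ barKerHat ∩ Δ^tp_X`) are NOT formal: they need
`#((Δ^tp_Y)^ell ⊗ ℤ/l) = l` (census input P-C9, `hYcl` class) and are the bridging lemma owed by the
`CoverDataAx.ofSetting` file (owner abc-iut-L2-t10). Nothing here takes a side on [IUTchIII] Cor. 3.12;
typed ≠ proved.
-/

noncomputable section

namespace Literature.AnabelianGeometry.EtaleTheta.ThetaSetting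

variable {p : ℕ} [Fact p.Prime] (D : ThetaSetting p) (l : ℕ)

/-- **`Ker(Δ^tp_X ↠ Δ̄_X) ≤ toHat⁻¹(Ker(Δ_X ↠ Δ̄_X))`**: the tempered kernel (through the theta quotient) maps
into the profinite one (closure in `Π_X`). [cite: MochizukiEtTh2009, Def 2.1 p.35] -/
theorem barKerTp_le_comap_barKerHat :
    D.barKerTp l ≤ (D.barKerHat l).comap D.toHat.toMonoidHom := by
  intro x hx
  obtain ⟨-, hxP⟩ := (D.mem_barKerTp_iff l).1 hx
  -- `θ⁻¹(⟨l-th powers of θ(Δ^tp)⟩) = ⟨l-th powers of Δ^tp⟩ ⊔ Ker θ`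
  have hgen : D.powTheta l = (Subgroup.closure {y : D.PiTemp | ∃ d ∈ D.DeltaTemp, y = d ^ l}).map D.toTheta := by
    rw [MonoidHom.map_closure]
    unfold powTheta
    congr 1
    ext t
    constructor
    · rintro ⟨s, ⟨d, hd, rfl⟩, rfl⟩
      exact ⟨d ^ l, ⟨d, hd, rfl⟩, by rw [map_pow]⟩
    · rintro ⟨y, ⟨d, hd, rfl⟩, rfl⟩
      exact ⟨D.toTheta d, ⟨d, hd, rfl⟩, by rw [map_pow]⟩
  have hx' : x ∈ (D.powTheta l).comap D.toTheta := hxP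
  rw [hgen, Subgroup.comap_map_eq] at hx'
  rw [Subgroup.mem_comap]
  refine (sup_le ?_ ?_ : Subgroup.closure {y : D.PiTemp | ∃ d ∈ D.DeltaTemp, y = d ^ l} ⊔ D.toTheta.ker ≤
      (D.barKerHat l).comap D.toHat.toMonoidHom) hx'
  · rw [Subgroup.closure_le]
    rintro _ ⟨d, hd, rfl⟩
    rw [SetLike.mem_coe, Subgroup.mem_comap, map_pow]
    refine D.pow_mem_barKerHat l ?_
    rw [← D.comap_toHat_deltaHat] at hd
    exact hd
  · exact D.ker_toTheta_le_comap_barKerHat l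

/-- **The tempered `Δ̄_Θ`-preimage maps into the profinite one**: `barThetaTp l ≤ toHat⁻¹(barThetaHat l)`.
[cite: MochizukiEtTh2009, Def 2.1 p.35] -/
theorem barThetaTp_le_comap_barThetaHat :
    D.barThetaTp l ≤ (D.barThetaHat l).comap D.toHat.toMonoidHom := by
  intro x hx
  obtain ⟨-, hxP⟩ := (D.mem_barThetaTp_iff l).1 hx
  haveI := D.powTheta_normal l
  obtain ⟨q, hq, z, hz, hqz⟩ := Subgroup.mem_sup_of_normal_left.1 hxP
  -- lift `q ∈ ⟨l-th powers⟩ ≤ (Δ^tp_X)^Θ` to `y ∈ Δ^tp_X`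
  obtain ⟨y, hy, hyq⟩ := (D.powTheta_le_dtpTheta l) hq
  have hyK : y ∈ D.barKerTp l := (D.mem_barKerTp_iff l).2 ⟨hy, by rw [hyq]; exact hq⟩
  -- `x = y · (y⁻¹ x)` with `θ(y⁻¹ x) = z ∈ Δ_Θ`, i.e. `y⁻¹ x ∈ Ker(Π^tp_X ↠ (Π^tp_X)^ell)`
  have hw : y⁻¹ * x ∈ (D.thetaToEll.comp D.toTheta).ker := by
    rw [MonoidHom.mem_ker, MonoidHom.comp_apply, map_mul, map_inv, hyq, ← hqz, ← mul_assoc,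
      inv_mul_cancel, one_mul]
    exact hz
  have e : x = y * (y⁻¹ * x) := by group
  rw [e, Subgroup.mem_comap, map_mul]
  refine (D.barThetaHat l).mul_mem ?_ ?_
  · exact D.barKerHat_le_barThetaHat l (D.barKerTp_le_comap_barKerHat l hyK)
  · exact D.ker_toEll_le_comap_barThetaHat l hw


end Literature.AnabelianGeometry.EtaleTheta.ThetaSetting

end
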